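import Mathlib
import Literature.Analysis.FluidPDE.TypeIAncientMild
import Literature.Analysis.FluidPDE.PineauVicolRSS
import Summits.NavierStokesRegularity.NavierStokesRegularity.Theses.SymmetryModuliCount
import Summits.NavierStokesRegularity.NavierStokesRegularity.Theorems.SymmetryModuliCountForcedSymmetryCollapse
import HarnessLib

/-!
# Crux `ForcedSymmetry` (stmt-NavierStokesRegularity-4052) — STRATEGIST SPLIT SKETCH (not filed)

Crux-strategist `planner-cstrat-stmt-NavierStokesRegularity-4052-0`, 2026-08-16. Companion of
`Cruxes/ForcedSymmetry/STRATEGY-CENSUS.md` §Decomposition D1: the BEST TYPED SPLIT of the node that this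
seat could produce, written so that a tenure planner (or the human at the lead's wind-down) can execute it
in one command. The two sub-statements are VERBATIM the registered stubs A2' (`stub_solitonSelection`)
and B5b (`stub_windowLiouville`) of the live line `killing-twisted-bernoulli-solitons` on crux
stmt-NavierStokesRegularity-1217 (`TypeICertificateLadder.NoTypeIBlowup`), so that filing them as items
here would SHARE the statements with that line rather than fork them. The glue
`forcedSymmetry_of_subs : (WindowRssLiouville → RssLiouvillePV) → SolitonSelection → WindowRssLiouville →
ForcedSymmetry` is sorry-free; its first argument is LITERALLY the statement of the landed theorem
`Theorems.rssLiouville_of_windowLiouville` (p107094, `Theorems/TypeICertificateLadderTargetSolitonReduction.lean`;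
Pineau–Vicol Thm 1.4 + B1–B4 of that line), taken as a hypothesis only because that module was not yet
built on the Lean farm when this file was checked (remote:stale:unbuilt); with the module built,
`forcedSymmetry_of_subs Theorems.rssLiouville_of_windowLiouville` is the two-hypothesis glue
`SolitonSelection → WindowRssLiouville → ForcedSymmetry`. The other ingredient is
`Theorems.forcedSymmetry_of_typeIAncientLiouville` (time-anchor collapse file, imported).
Which piece remains the whole crux: `SolitonSelection` (tangent-flow rigidity at `−∞`; census §T5/§D1).
Nothing here is proposed to the tree; it is evidence for the wind-down decision (route-shape is the
planners'/human's business, and the 2026-08-15 ruling defers this node's formal split to its final cycle).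
-/

noncomputable section

-- the summit and its single sub-problem share the name (CONVENTIONS §1)
set_option linter.dupNamespace false

namespace Summit.NavierStokesRegularity.NavierStokesRegularity.Cruxes.ForcedSymmetry.StrategistSplit

open Literature.Analysis.FluidPDE
open Summit.NavierStokesRegularity.NavierStokesRegularity.Theses.SymmetryModuliCount

/-- **Sub₁ — SOLITON SELECTION** (verbatim `stub_solitonSelection`, crux 1217 line
`killing-twisted-bernoulli-solitons`; OPEN, X-strength): a non-trivial element of the Oseen-gauge Type-I
rate class `IsTypeIAncientMild C` (`C > 0`) forces a non-trivial Type-I rotated self-similar soliton of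
Pineau–Vicol's class (classical on `[−1,0)`, apex decay `‖u‖ ≤ C₀/(‖x‖+√−t)`, `C²` profile `U ≠ 0`,
`u = pvAnsatz α U`). The NS analogue of "Type I ⇒ shrinking-soliton tangent flow"; no monotonicity
formula is known (the piece that remains the whole crux). -/
def SolitonSelection : Prop :=
  ∀ (C : ℝ), 0 < C → ∀ (v : ℝ → EuclideanSpace ℝ (Fin 3) → EuclideanSpace ℝ (Fin 3)), Literature.Analysis.FluidPDE.IsTypeIAncientMild C v → ¬ (∀ t < 0, ∀ x, v t x = 0) → ∃ C₀ : ℝ, 0 < C₀ ∧ ∃ (α : ℝ) (u : ℝ → EuclideanSpace ℝ (Fin 3) → EuclideanSpace ℝ (Fin 3)) (p : ℝ → EuclideanSpace ℝ (Fin 3) → ℝ) (U : EuclideanSpace ℝ (Fin 3) → EuclideanSpace ℝ (Fin 3)), Literature.Analysis.FluidPDE.IsClassicalNSSolutionOn (Set.Ico (-1) 0) 1 0 u p ∧ (∀ t ∈ Set.Ico (-1 : ℝ) 0, ∀ x : EuclideanSpace ℝ (Fin 3), ‖u t x‖ ≤ C₀ / (‖x‖ + Real.sqrt (-t))) ∧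 ContDiff ℝ 2 U ∧ (∀ t ∈ Set.Ico (-1 : ℝ) 0, ∀ x : EuclideanSpace ℝ (Fin 3), u t x = Literature.Analysis.FluidPDE.pvAnsatz α (fun y _ => U y) t x) ∧ U ≠ 0

/-- **Sub₂ — WINDOW RSS LIOUVILLE** (verbatim `stub_windowLiouville`, crux 1217; OPEN = Pineau–Vicol
Conj. 1.1 at `α ≈ 1` in the compact window `a₀ ≤ |α| ≤ A₀`, equipped with the rotating conjugate density,
the soliton enstrophy law `∫|curl U|²m ≤ 4α²` and identity — tools B1–B4 LANDED on crux 1217). -/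
def WindowRssLiouville : Prop :=
  ∀ C₀ : ℝ, 0 < C₀ → ∀ a₀ A₀ : ℝ, 0 < a₀ → a₀ ≤ A₀ → ∀ α : ℝ, a₀ ≤ |α| → |α| ≤ A₀ → ∀ (u : ℝ → EuclideanSpace ℝ (Fin 3) → EuclideanSpace ℝ (Fin 3)) (p : ℝ → EuclideanSpace ℝ (Fin 3) → ℝ) (U : EuclideanSpace ℝ (Fin 3) → EuclideanSpace ℝ (Fin 3)) (m : EuclideanSpace ℝ (Fin 3) → ℝ) (c M₁ : ℝ), Literature.Analysis.FluidPDE.IsClassicalNSSolutionOn (Set.Ico (-1) 0) 1 0 u p → (∀ t ∈ Set.Ico (-1 : ℝ) 0, ∀ x : EuclideanSpace ℝ (Fin 3), ‖u t x‖ ≤ C₀ / (‖x‖ + Real.sqrt (-t))) → ContDiff ℝ 2 U → (∀ t ∈ Set.Ico (-1 : ℝ) 0, ∀ x : EuclideanSpace ℝ (Fin 3), u t x = Literature.Analysis.FluidPDE.pvAnsatz α (fun y _ => U y) t x) → 0 < c → 0 < M₁ → (ContDiff ℝ 2 m ∧ (∀ y, 0 < m y) ∧ (∫ y, m y = 1)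 ∧ (∀ y, c * Real.exp (-(7 / 16 : ℝ) * ‖y‖ ^ 2) ≤ m y) ∧ (∀ y, m y ≤ M₁ * Real.exp (-(1 / 16 : ℝ) * ‖y‖ ^ 2)) ∧ (∃ M₂ : ℝ, ∀ y, ‖fderiv ℝ m y‖ ≤ M₂ * Real.exp (-(1 / 32 : ℝ) * ‖y‖ ^ 2)) ∧ (∀ y, Laplacian.laplacian m y + Literature.Analysis.FluidPDE.VectorCalculus.divergence (fun z => m z • (U z + (1 / 2 : ℝ) • z - α • Literature.Analysis.FluidPDE.rotGen z)) y = 0)) → (∫ y, ‖Literature.Analysis.FluidPDE.curl U y‖ ^ 2 * m y ≤ 4 * α ^ 2) → (∫ y, ‖Literature.Analysis.FluidPDE.curl U y‖ ^ 2 * m y = 2 * α * ∫ y, (Literature.Analysis.FluidPDE.curl U y) 2 * m y) → U = 0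

/-- Pineau–Vicol's Conjecture 1.1 in their class, ALL rotation rates `α` (the conclusion of the landed
`Theorems.rssLiouville_of_windowLiouville`, verbatim; = hypothesis `hL` of the 1217 skeleton's
`rateClassLiouville_of_parts`). -/
def RssLiouvillePV : Prop :=
  ∀ C₀ : ℝ, 0 < C₀ → ∀ (α : ℝ) (u : ℝ → EuclideanSpace ℝ (Fin 3) → EuclideanSpace ℝ (Fin 3)) (p : ℝ → EuclideanSpace ℝ (Fin 3) → ℝ) (U : EuclideanSpace ℝ (Fin 3) → EuclideanSpace ℝ (Fin 3)), Literature.Analysis.FluidPDE.IsClassicalNSSolutionOn (Set.Ico (-1) 0) 1 0 u p → (∀ t ∈ Set.Ico (-1 : ℝ) 0, ∀ x : EuclideanSpace ℝ (Fin 3), ‖u t x‖ ≤ C₀ / (‖x‖ + Real.sqrt (-t))) → ContDiff ℝ 2 U → (∀ t ∈ Set.Ico (-1 : ℝ) 0, ∀ x : EuclideanSpace ℝ (Fin 3), u t x = Literature.Analysis.FluidPDE.pvAnsatz α (fun y _ => U y) t x) → U = 0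

/-- A Type-I field with a non-positive rate constant vanishes (`‖u‖ ≤ C/√(−t) ≤ 0`). [elementary] -/
theorem eq_zero_of_hasTypeITimeDecay_nonpos {C : ℝ} (hC : C ≤ 0)
    {u : ℝ → EuclideanSpace ℝ (Fin 3) → EuclideanSpace ℝ (Fin 3)} (h : HasTypeITimeDecay C u) :
    ∀ t < 0, ∀ x, u t x = 0 := by
  intro t ht x
  have h1 : ‖u t x‖ ≤ C / Real.sqrt (-t) := h t ht x
  have h2 : C / Real.sqrt (-t) ≤ 0 := div_nonpos_of_nonpos_of_nonneg hC (Real.sqrt_nonneg _)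
  exact norm_le_zero_iff.1 (h1.trans h2)

/-- **The route target from selection + RSS Liouville (pure logic).** For `C ≤ 0` the class is `{0}`; for
`C > 0` a non-zero element would select a non-trivial Type-I RSS soliton of Pineau–Vicol's class
(`SolitonSelection`), which `RssLiouvillePV` kills. -/
theorem typeIAncientLiouville_of_selection (h1 : SolitonSelection) (hL : RssLiouvillePV) :
    TypeIAncientLiouville := by
  intro C u hu
  have hu' : IsTypeIAncientMild C u := isTypeIAncientMild_iff.2 hu
  by_cases hC : 0 < C
  · by_contra hnz
    obtain ⟨C₀, hC₀, α, v, p, U, hns, hI, hU, hA, hU0⟩ := h1 C hC u hu' hnz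
    exact hU0 (hL C₀ hC₀ α v p U hns hI hU hA)
  · exact eq_zero_of_hasTypeITimeDecay_nonpos (le_of_not_gt hC) hu.2.2.2

/-- **The split glue** in the shape `route edit --split ForcedSymmetry --into SolitonSelection WindowRssLiouville`
expects, modulo the landed reduction: `hred` is LITERALLY the statement of
`Theorems.rssLiouville_of_windowLiouville` (p107094: Thm 1.4 outside `[α₁, α₂]`, the landed B1–B4 below
`√ε₀/2`, window Liouville on the residual window), so `forcedSymmetry_of_subs rssLiouville_of_windowLiouville :
SolitonSelection → WindowRssLiouville → ForcedSymmetry`. Last step: `X ⇒ ForcedSymmetry`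
(`Theorems.forcedSymmetry_of_typeIAncientLiouville`, the vacuous direction of the kernel-checked equivalence
`forcedSymmetry_iff_typeIAncientLiouville`, p108644). -/
theorem forcedSymmetry_of_subs (hred : WindowRssLiouville → RssLiouvillePV) (h1 : SolitonSelection)
    (h2 : WindowRssLiouville) : ForcedSymmetry :=
  Summit.NavierStokesRegularity.NavierStokesRegularity.Theorems.forcedSymmetry_of_typeIAncientLiouville
    (typeIAncientLiouville_of_selection h1 (hred h2))

end Summit.NavierStokesRegularity.NavierStokesRegularity.Cruxes.ForcedSymmetry.StrategistSplit

end
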